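import Mathlib
import Summits.Ventures.DiscreteObjects.Mahler.SmallMeasureCensus

/-!
# Soundness of the census coefficient test (T2): coefficients of a product of reciprocal quadratics

Cell `pub-namedobj`, seat `pub-namedobj-mahler-g2`, target (L). Framing: lottery ticket; floor = certified
bounds/negative ranges.

The census engines (engine A in C, engine B in Python; `HOME/code/censusL`) prune the search for reciprocal
integer polynomials `P` of degree `n = 2d` with `M(P) < B` using the test

  `T2:  |a_j(P)| < [z^j] (1 + (B + 1/B) z + z²)(1 + z)^{n-2}`   (`0 < j < n`),

applied to `P` and to its Graeffe iterates. This file PROVES the inequality behind T2 for every complex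
polynomial of the shape `P = ∏_{i=1}^{d} (x² - tᵢ x + 1)` (`tᵢ ∈ ℂ`; every monic reciprocal polynomial with its
roots paired as `{α, 1/α}` has this shape, `tᵢ = αᵢ + 1/αᵢ`):

* coefficient domination tools: `Dominates Q q` (`‖q.coeff j‖ ≤ Q.coeff j`), `CoeffLE`, `CoeffNonneg`,
  stable under products (`Dominates.mul`, `Dominates.multiset_prod`, `CoeffLE.mul_right`);
* `quad_mahlerMeasure`: `M(x² - t x + 1) = e^{u}` with `u ≥ 0` and `|t| ≤ 2 cosh u`;
* `cosh_add_cosh_le`, `cosh_mul_cosh_le`: the two-term majorisation inequalities;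
* `majorize`: `∏ (x² + 2cosh(uᵢ) x + 1) ≤ (x² + 2cosh(Σuᵢ) x + 1)(x + 1)^{2(d-1)}` coefficientwise;
* `reciprocal_coeff_bound`: `|a_j(P)| ≤ [x^j] (x² + (M + 1/M) x + 1)(x² + 2x + 1)^{d-1}`, `M = M(P)`;
* `reciprocal_coeff_bound_strict`: if moreover `M(P) < B` then for `0 < j < n` the inequality with `B + 1/B`
  in place of `M + 1/M` is STRICT — exactly the rejection criterion T2 (the engines compare the integer `|a_j|`
  with `floor_strict` of the right-hand side).

Remaining gap (named, not hidden): the purely algebraic fact that a monic (anti)reciprocal integer polynomial of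
even degree factors over `ℂ` into such quadratics (after removing `x² - 1` in the antireciprocal case) is not
proved here; the theorems take the factorised shape as hypothesis.
-/

namespace Summit.Ventures.DiscreteObjects.Mahler

open Polynomial Finset

/-! ## Coefficient domination by real majorants -/

/-- `Q` dominates `q`: every coefficient of `q` is bounded in norm by the corresponding coefficient of `Q`. -/
def Dominates (Q : ℝ[X]) (q : ℂ[X]) : Prop :=
  ∀ j, ‖q.coeff j‖ ≤ Q.coeff j

/-- Coefficientwise order on real polynomials. -/
def CoeffLE (P Q : ℝ[X]) : Prop :=
  ∀ j, P.coeff j ≤ Q.coeff j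

/-- All coefficients nonnegative. -/
def CoeffNonneg (P : ℝ[X]) : Prop :=
  ∀ j, 0 ≤ P.coeff j

/-- A majorant has nonnegative coefficients. -/
theorem Dominates.coeffNonneg {Q : ℝ[X]} {q : ℂ[X]} (h : Dominates Q q) : CoeffNonneg Q :=
  fun j => le_trans (norm_nonneg _) (h j)

/-- `1` dominates `1`. -/
theorem dominates_one : Dominates 1 1 := by
  intro j
  rw [coeff_one, coeff_one]
  split_ifs <;> simp

/-- Domination is preserved by products (Cauchy product + triangle inequality). -/
theorem Dominates.mul {Q₁ Q₂ : ℝ[X]} {q₁ q₂ : ℂ[X]} (h₁ : Dominates Q₁ q₁) (h₂ : Dominates Q₂ q₂) :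
    Dominates (Q₁ * Q₂) (q₁ * q₂) := by
  intro j
  rw [coeff_mul, coeff_mul]
  refine le_trans (norm_sum_le _ _) (Finset.sum_le_sum ?_)
  intro x _
  rw [norm_mul]
  exact mul_le_mul (h₁ x.1) (h₂ x.2) (norm_nonneg _) (le_trans (norm_nonneg _) (h₁ x.1))

/-- Domination is preserved by multiset products. -/
theorem Dominates.multiset_prod {ι : Type*} (s : Multiset ι) (Q : ι → ℝ[X]) (q : ι → ℂ[X])
    (h : ∀ i ∈ s, Dominates (Q i) (q i)) :
    Dominates (s.map Q).prod (s.map q).prod := by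
  induction s using Multiset.induction_on with
  | empty => simpa using dominates_one
  | cons a s ih =>
    rw [Multiset.map_cons, Multiset.map_cons, Multiset.prod_cons, Multiset.prod_cons]
    exact (h a (Multiset.mem_cons_self a s)).mul
      (ih fun i hi => h i (Multiset.mem_cons_of_mem hi))

/-- Reflexivity of the coefficientwise order. -/
theorem CoeffLE.refl (P : ℝ[X]) : CoeffLE P P := fun _ => le_rfl

/-- Transitivity of the coefficientwise order. -/
theorem CoeffLE.trans {P Q R : ℝ[X]} (h₁ : CoeffLE P Q) (h₂ : CoeffLE Q R) : CoeffLE P R :=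
  fun j => le_trans (h₁ j) (h₂ j)

/-- Multiplying a coefficientwise inequality by a polynomial with nonnegative coefficients. -/
theorem CoeffLE.mul_right {P Q R : ℝ[X]} (h : CoeffLE P Q) (hR : CoeffNonneg R) :
    CoeffLE (P * R) (Q * R) := by
  intro j
  rw [coeff_mul, coeff_mul]
  exact Finset.sum_le_sum fun x _ => mul_le_mul_of_nonneg_right (h x.1) (hR x.2)

/-- Same on the left. -/
theorem CoeffLE.mul_left {P Q R : ℝ[X]} (h : CoeffLE P Q) (hR : CoeffNonneg R) :
    CoeffLE (R * P) (R * Q) := by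
  rw [mul_comm R P, mul_comm R Q]
  exact h.mul_right hR

/-- Products of polynomials with nonnegative coefficients have nonnegative coefficients. -/
theorem CoeffNonneg.mul {P Q : ℝ[X]} (hP : CoeffNonneg P) (hQ : CoeffNonneg Q) : CoeffNonneg (P * Q) := by
  intro j
  rw [coeff_mul]
  exact Finset.sum_nonneg fun x _ => mul_nonneg (hP x.1) (hQ x.2)

/-- `1` has nonnegative coefficients. -/
theorem coeffNonneg_one : CoeffNonneg 1 := by
  intro j; rw [coeff_one]; split_ifs <;> norm_num

/-- Powers of a polynomial with nonnegative coefficients have nonnegative coefficients. -/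
theorem CoeffNonneg.pow {P : ℝ[X]} (hP : CoeffNonneg P) (n : ℕ) : CoeffNonneg (P ^ n) := by
  induction n with
  | zero => simpa using coeffNonneg_one
  | succ n ih => rw [pow_succ]; exact ih.mul hP

/-- Transfer: a dominated polynomial's coefficients are bounded by any coefficientwise-larger majorant. -/
theorem Dominates.mono {Q Q' : ℝ[X]} {q : ℂ[X]} (h : Dominates Q q) (h' : CoeffLE Q Q') : Dominates Q' q :=
  fun j => le_trans (h j) (h' j)


/-! ## One reciprocal quadratic -/

/-- `M(x² - t x + 1) = e^u` with `u ≥ 0` and `|t| ≤ 2 cosh u` (the roots are `α, 1/α`, `u = |log|α||`). -/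
theorem quad_mahlerMeasure (t : ℂ) : ∃ u : ℝ, 0 ≤ u ∧
    (X ^ 2 - C t * X + 1 : ℂ[X]).mahlerMeasure = Real.exp u ∧ ‖t‖ ≤ 2 * Real.cosh u := by
  have hdeg : (X ^ 2 - C t * X + 1 : ℂ[X]).degree = 2 := by
    compute_degree!
  obtain ⟨α, hα⟩ := IsAlgClosed.exists_root (X ^ 2 - C t * X + 1 : ℂ[X]) (by rw [hdeg]; norm_num)
  have hroot : α ^ 2 - t * α + 1 = 0 := by
    have := hα.eq_zero
    simpa using this
  set β : ℂ := t - α with hβ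
  have hsum : α + β = t := by rw [hβ]; ring
  have hprod : α * β = 1 := by rw [hβ]; linear_combination (-1 : ℂ) * hroot
  have hα0 : α ≠ 0 := by
    intro h; rw [h, zero_mul] at hprod; exact zero_ne_one hprod
  have hfac : (X ^ 2 - C t * X + 1 : ℂ[X]) = (X - C α) * (X - C β) := by
    have : (X - C α) * (X - C β) = X ^ 2 - C (α + β) * X + C (α * β) := by
      rw [map_add, map_mul]; ring
    rw [this, hsum, hprod, map_one]
  set r : ℝ := ‖α‖ with hr
  have hr0 : 0 < r := by rw [hr]; exact norm_pos_iff.mpr hα0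
  have hβn : ‖β‖ = r⁻¹ := by
    have h := congrArg (fun z : ℂ => ‖z‖) hprod
    simp only [norm_mul, norm_one] at h
    rw [← hr] at h
    field_simp
    linarith [h]
  refine ⟨|Real.log r|, abs_nonneg _, ?_, ?_⟩
  · rw [hfac, mahlerMeasure_mul, mahlerMeasure_X_sub_C, mahlerMeasure_X_sub_C, ← hr, hβn]
    rcases le_or_gt 1 r with h1 | h1
    · have hlog : 0 ≤ Real.log r := Real.log_nonneg h1
      rw [abs_of_nonneg hlog, Real.exp_log hr0, max_eq_right h1,
        max_eq_left (inv_le_one_of_one_le₀ h1), mul_one]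
    · have hlog : Real.log r < 0 := Real.log_neg hr0 h1
      rw [abs_of_neg hlog, Real.exp_neg, Real.exp_log hr0, max_eq_left h1.le,
        max_eq_right (one_le_inv_iff₀.mpr ⟨hr0, h1.le⟩), one_mul]
  · rw [Real.cosh_abs, Real.cosh_eq, Real.exp_neg, Real.exp_log hr0, ← hsum]
    calc ‖α + β‖ ≤ ‖α‖ + ‖β‖ := norm_add_le _ _
      _ = r + r⁻¹ := by rw [← hr, hβn]
      _ = 2 * ((r + r⁻¹) / 2) := by ring

/-! ## Majorisation inequalities for `cosh` -/

/-- `cosh a + cosh b ≤ cosh (a+b) + 1` for `a, b ≥ 0`. -/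
theorem cosh_add_cosh_le {a b : ℝ} (ha : 0 ≤ a) (hb : 0 ≤ b) :
    Real.cosh a + Real.cosh b ≤ Real.cosh (a + b) + 1 := by
  rw [Real.cosh_add]
  have h1 := Real.one_le_cosh a
  have h2 := Real.one_le_cosh b
  have h3 : 0 ≤ Real.sinh a := Real.sinh_nonneg_iff.mpr ha
  have h4 : 0 ≤ Real.sinh b := Real.sinh_nonneg_iff.mpr hb
  nlinarith [mul_nonneg (sub_nonneg.mpr h1) (sub_nonneg.mpr h2), mul_nonneg h3 h4]

/-- `cosh a · cosh b ≤ cosh (a+b)` for `a, b ≥ 0`. -/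
theorem cosh_mul_cosh_le {a b : ℝ} (ha : 0 ≤ a) (hb : 0 ≤ b) :
    Real.cosh a * Real.cosh b ≤ Real.cosh (a + b) := by
  rw [Real.cosh_add]
  nlinarith [Real.sinh_nonneg_iff.mpr ha, Real.sinh_nonneg_iff.mpr hb,
    mul_nonneg (Real.sinh_nonneg_iff.mpr ha) (Real.sinh_nonneg_iff.mpr hb)]

/-! ## The bounding quadratics `x² + c x + 1` over `ℝ` -/

/-- Coefficients of `x² + c x + 1` over `ℝ`. -/
theorem coeff_realQuad (c : ℝ) (j : ℕ) : (X ^ 2 + C c * X + 1 : ℝ[X]).coeff j =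
    if j = 0 then 1 else if j = 1 then c else if j = 2 then 1 else 0 := by
  simp only [coeff_add, coeff_C_mul, coeff_X_pow, coeff_X, coeff_one]
  rcases j with _ | _ | _ | j <;> simp

/-- `x² + c x + 1` has nonnegative coefficients when `c ≥ 0`. -/
theorem coeffNonneg_realQuad {c : ℝ} (hc : 0 ≤ c) : CoeffNonneg (X ^ 2 + C c * X + 1 : ℝ[X]) := by
  intro j; rw [coeff_realQuad]; split_ifs <;> first | exact hc | norm_num

/-- Product of two bounding quadratics, expanded. -/
theorem realQuad_mul_realQuad (c c' : ℝ) :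
    (X ^ 2 + C c * X + 1 : ℝ[X]) * (X ^ 2 + C c' * X + 1) =
      X ^ 4 + C (c + c') * X ^ 3 + C (2 + c * c') * X ^ 2 + C (c + c') * X + 1 := by
  simp only [map_add, map_mul, map_ofNat]
  ring

/-- Coefficients of an explicit monic palindromic-shaped quartic over `ℝ`. -/
theorem coeff_realQuartic (a₁ a₂ a₃ : ℝ) (j : ℕ) :
    (X ^ 4 + C a₃ * X ^ 3 + C a₂ * X ^ 2 + C a₁ * X + 1 : ℝ[X]).coeff j =
      if j = 0 then 1 else if j = 1 then a₁ else if j = 2 then a₂ else if j = 3 then a₃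
        else if j = 4 then 1 else 0 := by
  simp only [coeff_add, coeff_C_mul, coeff_X_pow, coeff_X, coeff_one]
  rcases j with _ | _ | _ | _ | _ | j <;> simp

/-- The two-factor majorisation step, coefficientwise. -/
theorem realQuad_two_factor {a b : ℝ} (ha : 0 ≤ a) (hb : 0 ≤ b) :
    CoeffLE ((X ^ 2 + C (2 * Real.cosh a) * X + 1 : ℝ[X]) * (X ^ 2 + C (2 * Real.cosh b) * X + 1))
      ((X ^ 2 + C (2 * Real.cosh (a + b)) * X + 1 : ℝ[X]) * (X ^ 2 + C 2 * X + 1)) := by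
  intro j
  rw [realQuad_mul_realQuad, realQuad_mul_realQuad, coeff_realQuartic, coeff_realQuartic]
  have h1 := cosh_add_cosh_le ha hb
  have h2 := cosh_mul_cosh_le ha hb
  split_ifs <;> nlinarith

/-- **Majorisation.** For `uᵢ ≥ 0`:
`∏ (x² + 2cosh(uᵢ) x + 1) ≤ (x² + 2cosh(Σ uᵢ) x + 1)·(x² + 2x + 1)^{d-1}` coefficientwise. -/
theorem majorize (w : Multiset ℝ) (hw : ∀ u ∈ w, 0 ≤ u) (hne : w ≠ 0) :
    CoeffLE (w.map fun u => (X ^ 2 + C (2 * Real.cosh u) * X + 1 : ℝ[X])).prod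
      ((X ^ 2 + C (2 * Real.cosh w.sum) * X + 1 : ℝ[X]) *
        (X ^ 2 + C 2 * X + 1) ^ (Multiset.card w - 1)) := by
  induction w using Multiset.induction_on with
  | empty => exact absurd rfl hne
  | cons a s ih =>
    have ha : 0 ≤ a := hw a (Multiset.mem_cons_self a s)
    have hs : ∀ u ∈ s, 0 ≤ u := fun u hu => hw u (Multiset.mem_cons_of_mem hu)
    rw [Multiset.map_cons, Multiset.prod_cons, Multiset.sum_cons, Multiset.card_cons]
    by_cases hs0 : s = 0
    · subst hs0
      simp only [Multiset.map_zero, Multiset.prod_zero, mul_one, Multiset.sum_zero, add_zero,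
        Multiset.card_zero, zero_add, Nat.sub_self, pow_zero]
      exact CoeffLE.refl _
    · have ih' := ih hs hs0
      have hsum : 0 ≤ s.sum := Multiset.sum_nonneg hs
      have hq2 : CoeffNonneg (X ^ 2 + C 2 * X + 1 : ℝ[X]) := coeffNonneg_realQuad (by norm_num)
      have hcard : Multiset.card s + 1 - 1 = (Multiset.card s - 1) + 1 := by
        have : 0 < Multiset.card s := Multiset.card_pos.mpr hs0
        omega
      rw [hcard, pow_succ (X ^ 2 + C 2 * X + 1 : ℝ[X]) (Multiset.card s - 1)]
      -- G_a * ∏_s ≤ G_a * (G_{U} * G2^(k-1)) ≤ (G_{a+U} * G_2) * G2^(k-1)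
      refine CoeffLE.trans (CoeffLE.mul_left ih' (coeffNonneg_realQuad (by positivity))) ?_
      rw [← mul_assoc, show ((X ^ 2 + C (2 * Real.cosh (a + s.sum)) * X + 1 : ℝ[X]) *
          ((X ^ 2 + C 2 * X + 1) ^ (Multiset.card s - 1) * (X ^ 2 + C 2 * X + 1))) =
          ((X ^ 2 + C (2 * Real.cosh (a + s.sum)) * X + 1) * (X ^ 2 + C 2 * X + 1)) *
          (X ^ 2 + C 2 * X + 1) ^ (Multiset.card s - 1) by ring]
      exact CoeffLE.mul_right (realQuad_two_factor ha hsum) (hq2.pow _)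

/-! ## The coefficient bound -/

/-- Coefficients of `x² - t x + 1` over `ℂ`. -/
theorem coeff_cplxQuad (t : ℂ) (j : ℕ) : (X ^ 2 - C t * X + 1 : ℂ[X]).coeff j =
    if j = 0 then 1 else if j = 1 then -t else if j = 2 then 1 else 0 := by
  simp only [coeff_add, coeff_sub, coeff_C_mul, coeff_X_pow, coeff_X, coeff_one]
  rcases j with _ | _ | _ | j <;> simp

/-- `x² + 2cosh(u) x + 1` dominates `x² - t x + 1` when `|t| ≤ 2cosh u`. -/
theorem dominates_quad {t : ℂ} {u : ℝ} (h : ‖t‖ ≤ 2 * Real.cosh u) :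
    Dominates (X ^ 2 + C (2 * Real.cosh u) * X + 1 : ℝ[X]) (X ^ 2 - C t * X + 1 : ℂ[X]) := by
  intro j
  rw [coeff_cplxQuad, coeff_realQuad]
  split_ifs <;> simp [norm_neg, h]

/-- `exp` of a multiset sum is the product of the `exp`s. -/
theorem exp_multiset_sum (s : Multiset ℝ) : Real.exp s.sum = (s.map Real.exp).prod := by
  induction s using Multiset.induction_on with
  | empty => simp
  | cons a s ih => rw [Multiset.sum_cons, Real.exp_add, ih, Multiset.map_cons, Multiset.prod_cons]

/-- **T2 soundness (exact form).** For `P = ∏_{t ∈ s} (x² - t x + 1)` (`s ≠ ∅`, `d = |s|`), every coefficient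
satisfies `|a_j(P)| ≤ [x^j] (x² + (M + 1/M) x + 1)(x² + 2x + 1)^{d-1}` with `M = M(P)`. -/
theorem reciprocal_coeff_bound (s : Multiset ℂ) (hs : s ≠ 0) (j : ℕ) :
    ‖((s.map fun t => (X ^ 2 - C t * X + 1 : ℂ[X])).prod).coeff j‖ ≤
      ((X ^ 2 + C ((s.map fun t => (X ^ 2 - C t * X + 1 : ℂ[X])).prod.mahlerMeasure +
            ((s.map fun t => (X ^ 2 - C t * X + 1 : ℂ[X])).prod.mahlerMeasure)⁻¹) * X + 1 : ℝ[X]) *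
        (X ^ 2 + C 2 * X + 1) ^ (Multiset.card s - 1)).coeff j := by
  classical
  -- choose the exponents u(t)
  choose u hu0 huM hut using quad_mahlerMeasure
  -- domination by the product of bounding quadratics
  have hdom : Dominates ((s.map u).map fun v => (X ^ 2 + C (2 * Real.cosh v) * X + 1 : ℝ[X])).prod
      (s.map fun t => (X ^ 2 - C t * X + 1 : ℂ[X])).prod := by
    rw [Multiset.map_map]
    exact Dominates.multiset_prod s _ _ fun t _ => dominates_quad (hut t)
  -- majorisation
  have hw : ∀ v ∈ s.map u, 0 ≤ v := by
    intro v hv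
    obtain ⟨t, _, rfl⟩ := Multiset.mem_map.mp hv
    exact hu0 t
  have hne : s.map u ≠ 0 := by simpa using hs
  have hmaj := majorize (s.map u) hw hne
  rw [Multiset.card_map] at hmaj
  -- the Mahler measure of the product
  have hM : (s.map fun t => (X ^ 2 - C t * X + 1 : ℂ[X])).prod.mahlerMeasure = Real.exp (s.map u).sum := by
    rw [prod_mahlerMeasure_eq_mahlerMeasure_prod, Multiset.map_map, exp_multiset_sum, Multiset.map_map]
    congr 1
    exact Multiset.map_congr rfl fun t _ => huM t
  have hcosh : 2 * Real.cosh (s.map u).sum =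
      (s.map fun t => (X ^ 2 - C t * X + 1 : ℂ[X])).prod.mahlerMeasure +
        ((s.map fun t => (X ^ 2 - C t * X + 1 : ℂ[X])).prod.mahlerMeasure)⁻¹ := by
    rw [hM, Real.cosh_eq, Real.exp_neg]; ring
  rw [← hcosh]
  exact (hdom.mono hmaj) j

/-- Coefficients of `(x² + c x + 1)·R` are monotone in `c` when `R` has nonnegative coefficients, strictly so at
indices `j` with `R.coeff (j-1) > 0`, `j ≥ 1`. -/
theorem coeff_realQuad_mul (c : ℝ) (R : ℝ[X]) (j : ℕ) :
    ((X ^ 2 + C c * X + 1 : ℝ[X]) * R).coeff (j + 1) = R.coeff (j + 1) + c * R.coeff j +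
      (if j = 0 then 0 else R.coeff (j - 1)) := by
  have : (X ^ 2 + C c * X + 1 : ℝ[X]) * R = R + C c * (X * R) + X ^ 2 * R := by ring
  rw [this, coeff_add, coeff_add, coeff_C_mul, coeff_X_mul, coeff_X_pow_mul']
  rcases j with _ | j
  · simp
  · simp only [Nat.succ_ne_zero, if_false, show 2 ≤ j + 1 + 1 from by omega, if_true]
    congr 1

/-- **T2 as used by the engines (strict form).** If `P = ∏_{t∈s}(x² - t x + 1)` has `M(P) < B` then for every
index `j` with `1 ≤ j` and `((x²+2x+1)^{d-1}).coeff (j-1) > 0` (i.e. `1 ≤ j ≤ 2d - 1`):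
`|a_j(P)| < [x^j] (x² + (B + 1/B) x + 1)(x² + 2x + 1)^{d-1}`. -/
theorem reciprocal_coeff_bound_strict (s : Multiset ℂ) (hs : s ≠ 0) {B : ℝ}
    (hB : (s.map fun t => (X ^ 2 - C t * X + 1 : ℂ[X])).prod.mahlerMeasure < B) (j : ℕ)
    (hj : 0 < ((X ^ 2 + C 2 * X + 1 : ℝ[X]) ^ (Multiset.card s - 1)).coeff j) :
    ‖((s.map fun t => (X ^ 2 - C t * X + 1 : ℂ[X])).prod).coeff (j + 1)‖ <
      ((X ^ 2 + C (B + B⁻¹) * X + 1 : ℝ[X]) * (X ^ 2 + C 2 * X + 1) ^ (Multiset.card s - 1)).coeff (j + 1) := by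
  set P := (s.map fun t => (X ^ 2 - C t * X + 1 : ℂ[X])).prod with hP
  set R := (X ^ 2 + C 2 * X + 1 : ℝ[X]) ^ (Multiset.card s - 1) with hR
  have h1 := reciprocal_coeff_bound s hs (j + 1)
  rw [← hP, ← hR] at h1
  refine lt_of_le_of_lt h1 ?_
  rw [coeff_realQuad_mul, coeff_realQuad_mul]
  -- M ≥ 1 (monic: product of monics), so M + 1/M < B + 1/B
  have hmonic : P.Monic := by
    rw [hP]; apply monic_multiset_prod_of_monic; intro t _
    monicity!
  have hM1 : 1 ≤ P.mahlerMeasure := by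
    apply one_le_mahlerMeasure_of_one_le_norm_leadingCoeff
    rw [hmonic.leadingCoeff, norm_one]
  have hMB : P.mahlerMeasure + P.mahlerMeasure⁻¹ < B + B⁻¹ := by
    have hB1 : 1 ≤ B := le_trans hM1 hB.le
    have hM0 : 0 < P.mahlerMeasure := by linarith
    have hB0 : 0 < B := by linarith
    have key : (B + B⁻¹) - (P.mahlerMeasure + P.mahlerMeasure⁻¹) =
        (B - P.mahlerMeasure) * (B * P.mahlerMeasure - 1) / (B * P.mahlerMeasure) := by
      field_simp; ring
    have hnum : 0 < (B - P.mahlerMeasure) * (B * P.mahlerMeasure - 1) := by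
      apply mul_pos (by linarith)
      nlinarith
    have : 0 < (B + B⁻¹) - (P.mahlerMeasure + P.mahlerMeasure⁻¹) := by rw [key]; positivity
    linarith
  have hRj : 0 ≤ (if j = 0 then (0 : ℝ) else R.coeff (j - 1)) := by
    split_ifs
    · exact le_rfl
    · exact (coeffNonneg_realQuad (by norm_num : (0:ℝ) ≤ 2)).pow _ _
  nlinarith [mul_lt_mul_of_pos_right hMB hj]

/-- Integer form: if `P ∈ ℤ[x]` factors over `ℂ` as `∏_{t∈s}(x² - t x + 1)` and `M(P) < B`, then
`|a_{j+1}(P)| < [x^{j+1}] (x² + (B + 1/B)x + 1)(x² + 2x + 1)^{|s|-1}` whenever `((x²+2x+1)^{|s|-1}).coeff j > 0`. -/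
theorem int_reciprocal_coeff_bound_strict (P : ℤ[X]) (s : Multiset ℂ) (hs : s ≠ 0)
    (hP : P.map (Int.castRingHom ℂ) = (s.map fun t => (X ^ 2 - C t * X + 1 : ℂ[X])).prod) {B : ℝ}
    (hB : intMahlerMeasure P < B) (j : ℕ)
    (hj : 0 < ((X ^ 2 + C 2 * X + 1 : ℝ[X]) ^ (Multiset.card s - 1)).coeff j) :
    (|P.coeff (j + 1)| : ℝ) <
      ((X ^ 2 + C (B + B⁻¹) * X + 1 : ℝ[X]) * (X ^ 2 + C 2 * X + 1) ^ (Multiset.card s - 1)).coeff (j + 1) := by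
  have hB' : (s.map fun t => (X ^ 2 - C t * X + 1 : ℂ[X])).prod.mahlerMeasure < B := by
    rw [← hP]; exact hB
  have h := reciprocal_coeff_bound_strict s hs hB' j hj
  rw [← hP, coeff_map] at h
  simpa [Complex.norm_intCast] using h

end Summit.Ventures.DiscreteObjects.Mahler
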